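import Summits.AtomisticToContinuum.FouriersLaw.Theorems.EmbeddedDrudeMourreGreenKuboContinuationHeatableInfrastructure
import Summits.AtomisticToContinuum.FouriersLaw.Theorems.EmbeddedDrudeMourreMourreDissolutionCosineBochner
import Summits.AtomisticToContinuum.FouriersLaw.Theorems.EmbeddedDrudeMourreMourreDissolutionFrameworkReduction
import Summits.AtomisticToContinuum.FouriersLaw.Theorems.EmbeddedDrudeMourreMourreDissolutionGibbsClustering
import HarnessLib

/-!
# `stub_canonicalSpectralMeasure` — registered stub S1 of line `FilterInvariance`
# (card `band-limited-krylov-dimerisation`), crux `EmbeddedDrudeMourre.GreenKuboContinuation`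
# (item stmt-AtomisticToContinuum-12597)

Target `Summits/AtomisticToContinuum/FouriersLaw/Theorems/EmbeddedDrudeMourreGreenKuboContinuationCanonicalSpectralMeasure.lean`
(`ledger propose --supports stmt-AtomisticToContinuum-12597`). The theorem name and signature of
`stub_canonicalSpectralMeasure` are REGISTERED and stay verbatim.

## Content

For the pinned anharmonic chain `P = pinnedChain ω₂ lam β γ` (all four parameters `> 0`) there is
ONE infinite-volume dynamics `D` with `D.carrier = bmGood P` (the Buttà–Marchioro flow) such that at
every `T > 0` some DLR Gibbs state `μ` is shift-invariant, preserved by `D`, has absolutely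
convergent summed current autocorrelation `C(t) = D.currentCorrelation μ t`, and `C` is the cosine
transform of a finite EVEN measure `σ` on `ℝ`: `C(t) = ∫ cos(ωt) dσ(ω)`.

## Proof (pure assembly of landed infrastructure)

1. The all-temperature symmetric framework of the sibling crux `MourreDissolution`
   (`symmetricFramework_of_clustering` fed with the landed `stub_gibbsClustering`): one `D` with
   carrier `bmGood` and, at every `T > 0`, Doyon's zero-wavenumber data `Z` with `Z.μ` a DLR state
   at `T`, momentum-reversal symmetry and a strongly continuous Koopman group `U_t` on `ℋ₀`.
2. `μ := Z.μ`: shift invariance is the field `measurePreserving_shift 1` (`chainShift 1 = shift`),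
   `D.PreservesMeasure μ` and absolute convergence are the `ZeroWavenumberData` API.
3. `C(t) = ⟪[J], U_t [J]⟫₀` (`inner_currentClass_koopman_eq_currentCorrelation'`): continuous
   (strong continuity), even (`currentCorrelation_neg`) and of positive type
   (`sum_mul_currentCorrelation_nonneg`, `‖Σ cᵢ U_{τᵢ} [J]‖² ≥ 0`).
4. The cosine Bochner theorem (`stub_cosineBochner`) gives a finite `σ₀` with
   `C(t) = ∫ cos(ωt) dσ₀`; its symmetrisation `σ := ½(σ₀ + σ₀ ∘ (-)⁻¹)` is finite, even, and has the
   same cosine transform (`exists_even_measure_integral_cos_eq`).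
-/

noncomputable section

namespace Summit.AtomisticToContinuum.FouriersLaw.Theorems.GreenKuboContinuation.BandLimitedKrylov

open Filter Topology MeasureTheory Set
open Literature.MathematicalPhysics.KineticTheory.HeatConduction

section Symmetrisation

open scoped NNReal

/-- **Symmetrisation of a spectral measure.** For a finite measure `σ` on `ℝ` the measure
`σ' := ½ (σ + σ ∘ (ω ↦ -ω)⁻¹)` is finite, even (`σ' ∘ (ω ↦ -ω)⁻¹ = σ'`), and has the same cosine
transform: `∫ cos(ωt) dσ' = ∫ cos(ωt) dσ` (because `cos(-ωt) = cos(ωt)`). [folklore] -/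
theorem exists_even_measure_integral_cos_eq (σ : Measure ℝ) [IsFiniteMeasure σ] :
    ∃ σ' : Measure ℝ, IsFiniteMeasure σ' ∧ σ'.map (fun ω : ℝ => -ω) = σ' ∧
      ∀ t : ℝ, ∫ ω, Real.cos (ω * t) ∂σ' = ∫ ω, Real.cos (ω * t) ∂σ := by
  have hme : Measurable (fun ω : ℝ => -ω) := measurable_neg
  have hemb : MeasurableEmbedding (fun ω : ℝ => -ω) := (Homeomorph.neg ℝ).measurableEmbedding
  have hinv : (fun ω : ℝ => -ω) ∘ (fun ω : ℝ => -ω) = id := by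
    funext ω
    simp
  refine ⟨(2⁻¹ : ℝ≥0) • (σ + σ.map (fun ω : ℝ => -ω)), inferInstance, ?_, fun t => ?_⟩
  · rw [Measure.map_smul, Measure.map_add _ _ hme, Measure.map_map hme hme, hinv, Measure.map_id,
      add_comm]
  · have hint : ∀ μ : Measure ℝ, IsFiniteMeasure μ → Integrable (fun ω : ℝ => Real.cos (ω * t)) μ := by
      intro μ _
      refine (integrable_const (1 : ℝ)).mono' (by fun_prop) (ae_of_all _ fun ω => ?_)
      rw [Real.norm_eq_abs]
      exact Real.abs_cos_le_one _
    rw [integral_smul_nnreal_measure, integral_add_measure (hint σ inferInstance)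
      (hint _ inferInstance), hemb.integral_map]
    simp only [neg_mul, Real.cos_neg]
    rw [NNReal.smul_def, smul_eq_mul]
    push_cast
    ring

end Symmetrisation

section PositiveType

open scoped InnerProductSpace

/-- **The summed current autocorrelation of Doyon's zero-wavenumber data is a cosine transform of a
finite even measure.** If `Z` has momentum-reversal symmetry and a strongly continuous Koopman
group, then `C(t) = D.currentCorrelation Z.μ t = ⟪[J], U_t [J]⟫₀` is continuous, even and of
positive type, so by the cosine Bochner theorem and symmetrisation `C(t) = ∫ cos(ωt) dσ(ω)` for a
finite measure `σ` with `σ ∘ (ω ↦ -ω)⁻¹ = σ`. [folklore] -/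
theorem exists_even_spectralMeasure_of_zeroWavenumberData {P : OscillatorChain}
    {D : InfiniteChainDynamics P} (Z : ZeroWavenumberData P D) (hRev : Z.HasMomentumReversal)
    (hsc : ∀ ψ : ZeroWavenumberSpace Z, Continuous fun t : ℝ => Z.koopman t ψ) :
    ∃ σ : Measure ℝ, IsFiniteMeasure σ ∧ σ.map (fun ω : ℝ => -ω) = σ ∧
      ∀ t : ℝ, D.currentCorrelation Z.μ t = ∫ ω, Real.cos (ω * t) ∂σ := by
  -- continuity: `C(t) = ⟪[J], U_t [J]⟫₀` with `t ↦ U_t [J]` continuous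
  have hcont : Continuous (D.currentCorrelation Z.μ) := by
    have h : Continuous fun t : ℝ => ⟪Z.currentClass, Z.koopman t Z.currentClass⟫_ℝ :=
      continuous_const.inner (hsc Z.currentClass)
    exact h.congr fun t => Z.inner_currentClass_koopman_eq_currentCorrelation' hRev t
  -- evenness and positive type (orthogonality of `U_t` on the real Hilbert space `ℋ₀`)
  have heven : ∀ t : ℝ, D.currentCorrelation Z.μ (-t) = D.currentCorrelation Z.μ t :=
    Z.currentCorrelation_neg hRev
  have hpsd : ∀ (n : ℕ) (c τ : Fin n → ℝ),
      0 ≤ ∑ i, ∑ j, c i * c j * D.currentCorrelation Z.μ (τ j - τ i) :=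
    fun n c τ => Z.sum_mul_currentCorrelation_nonneg hRev Finset.univ c τ
  -- cosine Bochner theorem, then symmetrise
  obtain ⟨σ₀, hσ₀, hcos⟩ :=
    Summit.AtomisticToContinuum.FouriersLaw.Theorems.MourreDissolution.stub_cosineBochner
      (D.currentCorrelation Z.μ) hcont heven hpsd
  haveI : IsFiniteMeasure σ₀ := hσ₀
  obtain ⟨σ, hσ, hσeven, hσcos⟩ := exists_even_measure_integral_cos_eq σ₀
  refine ⟨σ, hσ, hσeven, fun t => ?_⟩
  rw [hσcos t]
  exact hcos t

end PositiveType

/-- **S1 `stub_canonicalSpectralMeasure`.** For `P = pinnedChain ω₂ lam β γ` (all `> 0`) there is ONE dynamics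
`D` with `D.carrier = bmGood P` (the Buttà–Marchioro flow) such that at every `T > 0` some DLR Gibbs state `μ`
is shift-invariant, preserved by `D`, with absolutely convergent summed current autocorrelation, and the
autocorrelation is the cosine transform of a finite EVEN measure `σ` on `ℝ`:
`C_{D,μ}(t) = ∫ cos(ωt) dσ(ω)` (the all-temperature symmetric framework
`symmetricFramework_of_clustering` + `stub_gibbsClustering` of the sibling crux `MourreDissolution`:
Doyon's zero-wavenumber data `Z` with momentum reversal and a strongly continuous Koopman group;
`μ := Z.μ`; positive type via the orthogonal Koopman group; cosine Bochner theorem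
`stub_cosineBochner`; symmetrisation `σ ↦ ½(σ + σ∘(-))` for evenness). [folklore] -/
theorem stub_canonicalSpectralMeasure :
    ∀ ω₂ lam β γ : ℝ, 0 < ω₂ → 0 < lam → 0 < β → 0 < γ →
      ∃ D : InfiniteChainDynamics (pinnedChain ω₂ lam β γ),
        D.carrier = (pinnedChain ω₂ lam β γ).bmGood ∧
        ∀ T : ℝ, 0 < T → ∃ (μ : Measure ChainConfig) (σ : Measure ℝ),
          (pinnedChain ω₂ lam β γ).IsChainGibbsMeasure T μ ∧ IsShiftInvariant μ ∧
          D.PreservesMeasure μ ∧ (∀ t : ℝ, D.HasAbsConvergentCorrelation μ t) ∧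
          IsFiniteMeasure σ ∧ σ.map (fun ω : ℝ => -ω) = σ ∧
          ∀ t : ℝ, D.currentCorrelation μ t = ∫ ω, Real.cos (ω * t) ∂σ := by
  intro ω₂ lam β γ hω hl hβ hγ
  -- 1. the all-temperature symmetric framework: one dynamics `D`, and `Z` at every `T > 0`
  obtain ⟨D, hDcar, hfam⟩ :=
    Summit.AtomisticToContinuum.FouriersLaw.Theorems.MourreDissolution.symmetricFramework_of_clustering
      Summit.AtomisticToContinuum.FouriersLaw.Theorems.MourreDissolution.stub_gibbsClustering
      ω₂ lam β γ hω hl hβ hγ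
  refine ⟨D, hDcar, fun T hT => ?_⟩
  obtain ⟨Z, hG, -, hRev, -, -, -, hsc⟩ := hfam T hT
  -- 2.–4. the state `Z.μ` and its even spectral measure
  have hmean : ∫ σ, (pinnedChain ω₂ lam β γ).bondCurrentZ σ 0 ∂Z.μ = 0 :=
    Z.integral_bondCurrent_eq_zero hRev
  obtain ⟨σ, hσ, hσeven, hcos⟩ := exists_even_spectralMeasure_of_zeroWavenumberData Z hRev hsc
  refine ⟨Z.μ, σ, hG, ?_, Z.preservesMeasure, fun t => Z.hasAbsConvergentCorrelation hmean t, hσ,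
    hσeven, hcos⟩
  -- shift invariance: `chainShift 1 = shift` preserves `Z.μ`
  exact (Z.measurePreserving_shift 1).map_eq

end Summit.AtomisticToContinuum.FouriersLaw.Theorems.GreenKuboContinuation.BandLimitedKrylov

end
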